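/-
Copyright (c) 2026 the pub-hodgecm-mathlib formalisation cell (harness21).  Prover seat hodgecm-mathlib-R90-C133-p02 (g0), Track B ∕ R90-TF, h413 = `stmt-HodgeConjecture-24833`,
R90-TF section S8 «ContSpec-n½» (deal S8-R55 of R90-CS-plan (g2), 2026-09-04T22:36Z: «F5 ED. 3» — split into its own file by the 400-line law): the MIDDLE POLE `z = 3/2` (`s = ½`)
of the continued `χ`-scattering coordinate of `U(2,1)_{L∕L⁺}` in CHARACTER FORM — the analytic half of the (NV) letter of socket #3 `sock_S8_res_piN_occurs`.
-/
import Summits.HodgeConjecture.HodgeConjecture.Theorems.K2E1ChiScatteringPoleDichotomyU3     -- ★ p862553∕p862588 (this seat, F5): `tendsto_sub_three_halves_mul_qc`, `forall_poles_of_residue_ne_zero_cm_three`; brings ★ F4 `exists_differentiableOn_mul_chiScalar_cm_three`, ★ `LHalfNeZero`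
import HarnessLib

/-!
# K2·E1 ∕ R90·S8 — `K2E1ChiScatteringMiddlePoleU3`: THE MIDDLE POLE `z = 3/2` OF THE `χ`-SCATTERING COORDINATE OF `U(2,1)_{L∕L⁺}` —
# `ρ_{3/2} = −A(3/2)·G(3/2)`, and for `φ ≠ 1`: `ρ_{3/2} ≠ 0 ⟺ η = 1 ∧ A(3/2) ≠ 0 ∧ L(½, φ) ≠ 0` (Rogawski's case (ii)), the analytic half of (NV)

Track B ∕ R90-TF, crux h413 = `stmt-HodgeConjecture-24833`, route of record `HCCMUnconditional`; cell `hodgecm-mathlib`, R90-TF section S8 «ContSpec-n½ ∕ ResidualSpectrum»; deal S8-R55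
(«the (NV) direction is SUFFICIENCY at the middle pole»).  THEOREMS ONLY (no `def`, no `instance`, no notation, no named-fact hypothesis, no `sorry`; default heartbeats); lane
`--supports stmt-HodgeConjecture-24833 --as helper` (count-neutral).  CLOSES NO SOCKET: it is the scattering-side half of the letter (NV) «`LHalfNeZero (ξ.bcη⁻¹ * μω) → ρ_{3/2} ≠ 0`»
of #3 (`Lines/R90_S8_ResidualSpectrumU3B.lean` :409), modulo the one-source letter (`hsrc`, value `A (3/2) ≠ 0`) and B1-local ∕ B2; the representation half «`ρ ≠ 0 ⇒ resGMidAtom ξ ≠ ⊥`»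
opens on K2E1-p11's G-DEFS.

THE MATHEMATICS ([Rogawski1990, §13.9 p. 229 (ii)] through `s = z − 1`; [MoeglinWaldspurger1995, IV.1.11]).  ★ F5 `tendsto_sub_three_halves_mul_qc`: with the continuation IN SHAPE
`(z−2)(2z−3)·M = G` on the tube, `(z − 3/2)·qc z → −A(3/2)·G(3/2)`; ★ F4 `exists_differentiableOn_mul_chiScalar_cm_three` supplies `G` for `M := c_χ^S` with the middle clauses
`η ≠ 1 → G(3/2) = 0` and `η = 1 → φ ≠ 1 → (G(3/2) ≠ 0 ↔ LHalfNeZero φ)`.  Hence `ρ_{3/2} ≠ 0 ⟺ A(3/2) ≠ 0 ∧ G(3/2) ≠ 0`, and for `φ ≠ 1`: `⟺ η = 1 ∧ A(3/2) ≠ 0 ∧ LHalfNeZero φ`.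
F4 does not export the value `G(3/2)` in the corner `(φ, η) = (1, 1)` (R90-CS-p03's HONEST SCOPE), whence the guard `φ ≠ 1`; in the S8 application `η = φ′·ω_{L∕L⁺}` and `φ = 1`
forces `η = ω ≠ 1`, so the corner is void there.
* §1 `residue_at_threeHalves_eq_cm_three` (`∃ G`, F4's middle clauses, `ρ = −(A (3/2) * G (3/2))`, `ρ ≠ 0 ↔ A (3/2) ≠ 0 ∧ G (3/2) ≠ 0`);
  **`residue_at_threeHalves_ne_zero_iff_cm_three`** (`φ ≠ 1`: `ρ ≠ 0 ↔ η = 1 ∧ A (3/2) ≠ 0 ∧ LHalfNeZero φ`); **`residue_at_threeHalves_ne_zero_of_lHalfNeZero_cm_three`** ((NV)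
  sufficiency: `η = 1 → φ ≠ 1 → LHalfNeZero φ → A (3/2) ≠ 0 → ρ ≠ 0`); `exists_residue_at_threeHalves_cm_three` (the residue-limit exists, so sufficiency is not vacuous).
HONEST LABEL: HC_CM is proved only modulo the 7 printed citations (2 remaining named inputs: hLiu418 = `stmt-HodgeConjecture-24832`, h413 = `stmt-HodgeConjecture-24833`) until
rung 0 closes; REL ≠ ★ ≠ BUILT; this file asserts no named fact, is conditional by construction on its visible binders (`hqcq hPcd hqa hsrc`), and closes no socket; count-neutral.

## References
* [Rogawski1990] J. D. Rogawski, *Automorphic Representations of Unitary Groups in Three Variables* (1990), §13.9 p. 229 (ii).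
* [MoeglinWaldspurger1995] C. Mœglin, J.-L. Waldspurger, *Spectral Decomposition and Eisenstein Series* (1995), IV.1.11.
-/

set_option autoImplicit false
set_option linter.dupNamespace false  -- the mandated namespace repeats the single-problem summit's segment

noncomputable section

open scoped NNReal
open Set Filter Topology Complex NumberField IsDedekindDomain
open Literature.NumberTheory.Automorphic Literature.NumberTheory.LFunctions Literature.NumberTheory.GaloisRepresentations
open Summit.HodgeConjecture.HodgeConjecture.Cruxes.H413.K2E1HeckeLHalfNeZeroDefs (LHalfNeZero)
open Summit.HodgeConjecture.HodgeConjecture.Cruxes.H413.K2E1ChiIntertwiningScalarEulerQuotientU3CM (exists_differentiableOn_mul_chiScalar_cm_three)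
open Summit.HodgeConjecture.HodgeConjecture.Cruxes.H413.K2E1ChiScatteringPoleDichotomyU3 (tendsto_sub_three_halves_mul_qc)

namespace Summit.HodgeConjecture.HodgeConjecture.Cruxes.H413.K2E1ChiScatteringMiddlePoleU3

/-! ## §1 The MIDDLE POLE `z = 3/2` in character form: the residue, its non-vanishing criterion for `φ ≠ 1`, and the (NV) sufficiency print -/

section Middle

variable (L : Type) [Field L] [NumberField L]

/-- **THE RESIDUE AT THE MIDDLE POLE `z = 3/2`, CHARACTER FORM**: any residue-limit `(z − 3/2)·qc z → ρ` IS `−A(3/2)·G(3/2)` for the ★ F4 continuation `G` — exported together with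
F4's two middle clauses `(η ≠ 1 → G (3/2) = 0)` and `(η = 1 → φ ≠ 1 → (G (3/2) ≠ 0 ↔ LHalfNeZero φ))` — so `ρ ≠ 0 ⟺ A (3/2) ≠ 0 ∧ G (3/2) ≠ 0`.  (F4 does not export the value of
`G (3/2)` in the corner `(φ, η) = (1, 1)` — p03's HONEST SCOPE — so the character-form criterion below carries `φ ≠ 1`; in the S8 application `η = φ′·ω_{L∕L⁺}`, where `φ = 1` forces
`η = ω ≠ 1`, the corner is void.) [cite: Rogawski1990, §13.9 p. 229 (ii)] [cite: MoeglinWaldspurger1995, IV.1.11] -/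
theorem residue_at_threeHalves_eq_cm_three {φ : HeckeCharacter L} {η : HeckeCharacter ↥(maximalRealSubfield L)}
    {S : Set (HeightOneSpectrum (𝓞 L))} {T : Set (HeightOneSpectrum (𝓞 ↥(maximalRealSubfield L)))}
    (hφ : φ.IsUnitary) (hφA : ∀ t : ℝ≥0ˣ, φ (posRealIdele L t) = 1) (hS : S.Finite) (hurφ : ∀ w ∉ S, φ.IsUnramifiedAt w)
    (hη : η.IsUnitary) (hηA : ∀ t : ℝ≥0ˣ, η (posRealIdele ↥(maximalRealSubfield L) t) = 1) (hT : T.Finite) (hurη : ∀ v ∉ T, η.IsUnramifiedAt v)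
    (q qc : ℂ → ℂ) {P : Set ℂ} (hqcq : ∀ z : ℂ, 2 < z.re → qc z = q z) (hPcd : ∀ z₀ : ℂ, ∀ᶠ s in 𝓝[≠] z₀, s ∉ P) (hqa : ∀ z : ℂ, z ∉ P → AnalyticAt ℂ qc z)
    (A : ℂ → ℂ) (hA : DifferentiableOn ℂ A {z : ℂ | 1 < z.re})
    (hsrc : ∀ z : ℂ, 2 < z.re → q z = A z *
          ((partialStandardL S (fun w => {φ.valueAtUniformizer w}) (z - 1) * partialStandardL T (fun v => {η.valueAtUniformizer v}) (2 * z - 2)) /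
            (partialStandardL S (fun w => {φ.valueAtUniformizer w}) z * partialStandardL T (fun v => {η.valueAtUniformizer v}) (2 * z - 1))))
    {ρ : ℂ} (hρ : Tendsto (fun z : ℂ => (z - 3 / 2) * qc z) (𝓝[≠] (3 / 2)) (𝓝 ρ)) :
    ∃ G : ℂ → ℂ, DifferentiableOn ℂ G {z : ℂ | 1 < z.re} ∧ (η ≠ 1 → G (3 / 2) = 0) ∧ (η = 1 → φ ≠ 1 → (G (3 / 2) ≠ 0 ↔ LHalfNeZero φ)) ∧
      ρ = -(A (3 / 2) * G (3 / 2)) ∧ (ρ ≠ 0 ↔ A (3 / 2) ≠ 0 ∧ G (3 / 2) ≠ 0) := by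
  obtain ⟨G, hG, hGeq, -, hG0, hG32⟩ := exists_differentiableOn_mul_chiScalar_cm_three L hφ hφA hS hurφ hη hηA hT hurη
  have hρeq : ρ = -(A (3 / 2) * G (3 / 2)) :=
    tendsto_nhds_unique hρ (tendsto_sub_three_halves_mul_qc q qc hqcq hPcd hqa A hA _ hsrc G hG hGeq)
  refine ⟨G, hG, hG0, hG32, hρeq, ?_⟩
  rw [hρeq, neg_ne_zero, mul_ne_zero_iff]

/-- **`ρ_{3/2} ≠ 0 ⟺ η = 1 ∧ A (3/2) ≠ 0 ∧ L(½, φ) ≠ 0`, for `φ ≠ 1`** — the middle pole of the `χ`-scattering coordinate of `U(2,1)_{L∕L⁺}` is a genuine pole exactly in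
Rogawski's case (ii) «`φ′ = ω_{L∕L⁺}` (⟺ `η = 1`), `s = ½`, `L(½, φ) ≠ 0`», modulo the one-source letter's value `A (3/2) ≠ 0`. [cite: Rogawski1990, §13.9 p. 229 (ii)]
[cite: MoeglinWaldspurger1995, IV.1.11] -/
theorem residue_at_threeHalves_ne_zero_iff_cm_three {φ : HeckeCharacter L} {η : HeckeCharacter ↥(maximalRealSubfield L)}
    {S : Set (HeightOneSpectrum (𝓞 L))} {T : Set (HeightOneSpectrum (𝓞 ↥(maximalRealSubfield L)))}
    (hφ : φ.IsUnitary) (hφA : ∀ t : ℝ≥0ˣ, φ (posRealIdele L t) = 1) (hS : S.Finite) (hurφ : ∀ w ∉ S, φ.IsUnramifiedAt w)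
    (hη : η.IsUnitary) (hηA : ∀ t : ℝ≥0ˣ, η (posRealIdele ↥(maximalRealSubfield L) t) = 1) (hT : T.Finite) (hurη : ∀ v ∉ T, η.IsUnramifiedAt v)
    (q qc : ℂ → ℂ) {P : Set ℂ} (hqcq : ∀ z : ℂ, 2 < z.re → qc z = q z) (hPcd : ∀ z₀ : ℂ, ∀ᶠ s in 𝓝[≠] z₀, s ∉ P) (hqa : ∀ z : ℂ, z ∉ P → AnalyticAt ℂ qc z)
    (A : ℂ → ℂ) (hA : DifferentiableOn ℂ A {z : ℂ | 1 < z.re})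
    (hsrc : ∀ z : ℂ, 2 < z.re → q z = A z *
          ((partialStandardL S (fun w => {φ.valueAtUniformizer w}) (z - 1) * partialStandardL T (fun v => {η.valueAtUniformizer v}) (2 * z - 2)) /
            (partialStandardL S (fun w => {φ.valueAtUniformizer w}) z * partialStandardL T (fun v => {η.valueAtUniformizer v}) (2 * z - 1))))
    (hφ1 : φ ≠ 1) {ρ : ℂ} (hρ : Tendsto (fun z : ℂ => (z - 3 / 2) * qc z) (𝓝[≠] (3 / 2)) (𝓝 ρ)) :
    ρ ≠ 0 ↔ η = 1 ∧ A (3 / 2) ≠ 0 ∧ LHalfNeZero φ := by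
  obtain ⟨G, -, hG0, hG32, -, hiff⟩ := residue_at_threeHalves_eq_cm_three L hφ hφA hS hurφ hη hηA hT hurη q qc hqcq hPcd hqa A hA hsrc hρ
  rw [hiff]
  constructor
  · rintro ⟨hA32, hG32ne⟩
    have hη1 : η = 1 := by
      by_contra h
      exact hG32ne (hG0 h)
    exact ⟨hη1, hA32, (hG32 hη1 hφ1).1 hG32ne⟩
  · rintro ⟨hη1, hA32, hL⟩
    exact ⟨hA32, (hG32 hη1 hφ1).2 hL⟩

/-- **(NV), ANALYTIC HALF — SUFFICIENCY AT THE MIDDLE POLE**: for `η = 1`, `φ ≠ 1`, `L(½, φ) ≠ 0` and `A (3/2) ≠ 0`, every residue-limit of `qc` at `3/2` is NON-ZERO («`πⁿ(ξ)` occurs in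
the discrete non-cuspidal spectrum if `L(½, φ) ≠ 0`», the scattering side). [cite: Rogawski1990, §13.9 p. 229 (ii)] [cite: MoeglinWaldspurger1995, IV.1.11] -/
theorem residue_at_threeHalves_ne_zero_of_lHalfNeZero_cm_three {φ : HeckeCharacter L} {η : HeckeCharacter ↥(maximalRealSubfield L)}
    {S : Set (HeightOneSpectrum (𝓞 L))} {T : Set (HeightOneSpectrum (𝓞 ↥(maximalRealSubfield L)))}
    (hφ : φ.IsUnitary) (hφA : ∀ t : ℝ≥0ˣ, φ (posRealIdele L t) = 1) (hS : S.Finite) (hurφ : ∀ w ∉ S, φ.IsUnramifiedAt w)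
    (hη : η.IsUnitary) (hηA : ∀ t : ℝ≥0ˣ, η (posRealIdele ↥(maximalRealSubfield L) t) = 1) (hT : T.Finite) (hurη : ∀ v ∉ T, η.IsUnramifiedAt v)
    (q qc : ℂ → ℂ) {P : Set ℂ} (hqcq : ∀ z : ℂ, 2 < z.re → qc z = q z) (hPcd : ∀ z₀ : ℂ, ∀ᶠ s in 𝓝[≠] z₀, s ∉ P) (hqa : ∀ z : ℂ, z ∉ P → AnalyticAt ℂ qc z)
    (A : ℂ → ℂ) (hA : DifferentiableOn ℂ A {z : ℂ | 1 < z.re})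
    (hsrc : ∀ z : ℂ, 2 < z.re → q z = A z *
          ((partialStandardL S (fun w => {φ.valueAtUniformizer w}) (z - 1) * partialStandardL T (fun v => {η.valueAtUniformizer v}) (2 * z - 2)) /
            (partialStandardL S (fun w => {φ.valueAtUniformizer w}) z * partialStandardL T (fun v => {η.valueAtUniformizer v}) (2 * z - 1))))
    (hη1 : η = 1) (hφ1 : φ ≠ 1) (hL : LHalfNeZero φ) (hA32 : A (3 / 2) ≠ 0)
    {ρ : ℂ} (hρ : Tendsto (fun z : ℂ => (z - 3 / 2) * qc z) (𝓝[≠] (3 / 2)) (𝓝 ρ)) : ρ ≠ 0 :=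
  (residue_at_threeHalves_ne_zero_iff_cm_three L hφ hφA hS hurφ hη hηA hT hurη q qc hqcq hPcd hqa A hA hsrc hφ1 hρ).2 ⟨hη1, hA32, hL⟩

/-- **… and the residue-limit EXISTS** (so the sufficiency is not vacuous): `(z − 3/2)·qc z → −A(3/2)·G(3/2)` for the ★ F4 continuation `G`; packaged as `∃ ρ, Tendsto … (𝓝 ρ) ∧ (φ ≠ 1 →
(ρ ≠ 0 ↔ η = 1 ∧ A (3/2) ≠ 0 ∧ LHalfNeZero φ))`. [cite: Rogawski1990, §13.9 p. 229 (ii)] [cite: MoeglinWaldspurger1995, IV.1.11] -/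
theorem exists_residue_at_threeHalves_cm_three {φ : HeckeCharacter L} {η : HeckeCharacter ↥(maximalRealSubfield L)}
    {S : Set (HeightOneSpectrum (𝓞 L))} {T : Set (HeightOneSpectrum (𝓞 ↥(maximalRealSubfield L)))}
    (hφ : φ.IsUnitary) (hφA : ∀ t : ℝ≥0ˣ, φ (posRealIdele L t) = 1) (hS : S.Finite) (hurφ : ∀ w ∉ S, φ.IsUnramifiedAt w)
    (hη : η.IsUnitary) (hηA : ∀ t : ℝ≥0ˣ, η (posRealIdele ↥(maximalRealSubfield L) t) = 1) (hT : T.Finite) (hurη : ∀ v ∉ T, η.IsUnramifiedAt v)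
    (q qc : ℂ → ℂ) {P : Set ℂ} (hqcq : ∀ z : ℂ, 2 < z.re → qc z = q z) (hPcd : ∀ z₀ : ℂ, ∀ᶠ s in 𝓝[≠] z₀, s ∉ P) (hqa : ∀ z : ℂ, z ∉ P → AnalyticAt ℂ qc z)
    (A : ℂ → ℂ) (hA : DifferentiableOn ℂ A {z : ℂ | 1 < z.re})
    (hsrc : ∀ z : ℂ, 2 < z.re → q z = A z *
          ((partialStandardL S (fun w => {φ.valueAtUniformizer w}) (z - 1) * partialStandardL T (fun v => {η.valueAtUniformizer v}) (2 * z - 2)) /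
            (partialStandardL S (fun w => {φ.valueAtUniformizer w}) z * partialStandardL T (fun v => {η.valueAtUniformizer v}) (2 * z - 1)))) :
    ∃ ρ : ℂ, Tendsto (fun z : ℂ => (z - 3 / 2) * qc z) (𝓝[≠] (3 / 2)) (𝓝 ρ) ∧ (φ ≠ 1 → (ρ ≠ 0 ↔ η = 1 ∧ A (3 / 2) ≠ 0 ∧ LHalfNeZero φ)) := by
  obtain ⟨G, hG, hGeq, -, -, -⟩ := exists_differentiableOn_mul_chiScalar_cm_three L hφ hφA hS hurφ hη hηA hT hurη
  have hlim := tendsto_sub_three_halves_mul_qc q qc hqcq hPcd hqa A hA _ hsrc G hG hGeq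
  exact ⟨_, hlim, fun hφ1 => residue_at_threeHalves_ne_zero_iff_cm_three L hφ hφA hS hurφ hη hηA hT hurη q qc hqcq hPcd hqa A hA hsrc hφ1 hlim⟩

end Middle

end Summit.HodgeConjecture.HodgeConjecture.Cruxes.H413.K2E1ChiScatteringMiddlePoleU3

end
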